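import Summits.CriticalPhenomena.PercolationContinuityZ3.Theorems.PercNearOneGluingNoHeavyLowerTailSahiE3IndepOrFlatTheta
import Summits.CriticalPhenomena.PercolationContinuityZ3.Theorems.PercNearOneGluingNoHeavyLowerTailSahiE3CertSandwich
import Summits.CriticalPhenomena.PercolationContinuityZ3.Theorems.PercNearOneGluingNoHeavyLowerTailSahiE3IndepOrReduction
import Mathlib.Tactic.Linarith
import Mathlib.Tactic.Ring
import Mathlib.Tactic.Positivity
import HarnessLib
import HarnessLib.Audit

/-!
# `NoHeavyLowerTail` (crux stmt-CriticalPhenomena-4575), Sahi programme P4 (Holley / monotone coupling):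
# the independent OR-step `V ∨ G` — a flat-θ composite with the pair inequality IS a flow certificate

Support file (cell `prim-l12`, seat P4, generation 18; `--supports stmt-CriticalPhenomena-4575`).  No named facts, no sorries;
standard axioms; def-free.

THEOREM `cert_of_flat_pair` (the plug for the independent OR-step).  Normalised Harris-free setting of `…SahiE3IndepOrFlatTheta`:
product weight `ν = w ⊗ ν'` on `B × Q` (`Σw = Σν' = 1`), `V ⊆ B`, `G ⊆ Q` with masses `v, v̄, g, ḡ`, sandwich certificates' cap parts
(C_V), (C_G) for `R_V, R_G ≥ 0`, flat-θ coefficients (`c₁, c₂ ≥ 0`, `c₁(1+v̄)+κ₁ = c₂(1+ḡ)+κ₂ = 1+v̄ḡ`, `c₁v + c₂g = v+v̄g`), the composite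
`R = (1+v̄ḡ)w⊗ν' | φ⊗ν' | w⊗ψ | 0` with `φ = c₁R_V + κ₁w ≥ 0` on `V`, `ψ = c₂R_G + κ₂ν' ≥ 0` on `G`.  IF `R` satisfies the pair inequality
  (L) `ν(S)ν(S'∩U) + ν(S')ν(S∩U) − (v+v̄g)·ν(S)ν(S') ≤ R(S∩S')`  for all up-sets `S, S'` of `B × Q`,
THEN `U = V × Q ∪ B × G` carries a flow certificate `(R', F)` in the sense of `…SahiE3PatternCertificate` ((R0), (F0), (F≤), (cap), (K),
(pair)) — (C) is `cap_flatTheta`, and `…SahiE3CertSandwich.exists_certificate_of_sandwich` turns the sandwich pair (L), (C) into flows.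
So the independent OR-step for the flat-θ family is EXACTLY the pair inequality (L); HOME prim-l12-p4 gen-18 memo §3b reduces it further
(θ = 1, OR-peeling) to one AND-gluing lemma.
-/

namespace Summit.CriticalPhenomena.PercolationContinuityZ3.Theorems.SahiE3IndepOrFlatCert

open Finset SahiE3IndepOrFlatTheta SahiE3CertSandwich
open scoped BigOperators

variable {B Q : Type*} [Fintype B] [DecidableEq B] [PartialOrder B] [Fintype Q] [DecidableEq Q] [PartialOrder Q]

/-- **A flat-θ composite satisfying the pair inequality is a flow certificate of `V ∨ G`.**  See the module docstring. [this work] -/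
theorem cert_of_flat_pair {w : B → ℝ} {ν' : Q → ℝ} (hw : ∀ b, 0 ≤ w b) (hν' : ∀ t, 0 ≤ ν' t)
    (hwZ : ∑ b, w b = 1) (hν'Z : ∑ t, ν' t = 1)
    (V : Finset B) (G : Finset Q) {v vb g gb : ℝ} (hv : ∑ b ∈ V, w b = v) (hvb : ∑ b ∈ Vᶜ, w b = vb)
    (hg : ∑ t ∈ G, ν' t = g) (hgb : ∑ t ∈ Gᶜ, ν' t = gb)
    (RV : B → ℝ) (RG : Q → ℝ) (hRV0 : ∀ b, 0 ≤ RV b) (hRG0 : ∀ t, 0 ≤ RG t)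
    (hCV : ∀ I : Finset B, IsUpperSet (I : Set B) →
      ∑ b ∈ I, RV b + v * ∑ b ∈ I ∩ Vᶜ, w b ≤ (1 + vb) * ∑ b ∈ I ∩ V, w b)
    (hCG : ∀ J : Finset Q, IsUpperSet (J : Set Q) →
      ∑ t ∈ J, RG t + g * ∑ t ∈ J ∩ Gᶜ, ν' t ≤ (1 + gb) * ∑ t ∈ J ∩ G, ν' t)
    {c₁ κ₁ c₂ κ₂ : ℝ} (hc₁ : 0 ≤ c₁) (hc₂ : 0 ≤ c₂) (hk₁ : c₁ * (1 + vb) + κ₁ = 1 + vb * gb)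
    (hk₂ : c₂ * (1 + gb) + κ₂ = 1 + vb * gb) (hdel : c₁ * v + c₂ * g = v + vb * g)
    (φ : B → ℝ) (hφ : ∀ b ∈ V, φ b = c₁ * RV b + κ₁ * w b) (hφ0 : ∀ b ∈ V, 0 ≤ φ b)
    (ψ : Q → ℝ) (hψ : ∀ t ∈ G, ψ t = c₂ * RG t + κ₂ * ν' t) (hψ0 : ∀ t ∈ G, 0 ≤ ψ t)
    (ν : B × Q → ℝ) (hν : ∀ x, ν x = w x.1 * ν' x.2)
    (R : B × Q → ℝ)
    (hR : ∀ x, R x = if x.1 ∈ V then (if x.2 ∈ G then (1 + vb * gb) * w x.1 * ν' x.2 else φ x.1 * ν' x.2)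
      else (if x.2 ∈ G then w x.1 * ψ x.2 else 0))
    (U : Finset (B × Q)) (hU : ∀ x, x ∈ U ↔ (x.1 ∈ V ∨ x.2 ∈ G))
    (hpair : ∀ S S' : Finset (B × Q), IsUpperSet (S : Set (B × Q)) → IsUpperSet (S' : Set (B × Q)) →
      (∑ x ∈ S, ν x) * (∑ x ∈ S' ∩ U, ν x) + (∑ x ∈ S', ν x) * (∑ x ∈ S ∩ U, ν x)
        - (v + vb * g) * (∑ x ∈ S, ν x) * (∑ x ∈ S', ν x) ≤ ∑ x ∈ S ∩ S', R x) :
    ∃ (R' : B × Q → ℝ) (F : (B × Q) → (B × Q) → ℝ),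
      (∀ t ∈ U, 0 ≤ R' t) ∧ (∀ t s, 0 ≤ F t s) ∧ (∀ t s, F t s ≠ 0 → s ≤ t) ∧
      (∀ t ∈ U, R' t + ∑ s ∈ Uᶜ, F t s ≤ (∑ r, ν r) * ((∑ r, ν r) + ∑ r ∈ Uᶜ, ν r) * ν t) ∧
      (∀ s ∈ Uᶜ, (∑ r, ν r) * (∑ r ∈ U, ν r) * ν s ≤ ∑ t ∈ U, F t s) ∧
      (∀ S S' : Finset (B × Q), IsUpperSet (S : Set (B × Q)) → IsUpperSet (S' : Set (B × Q)) →
        (∑ r, ν r) * ((∑ t ∈ S, ν t) * (∑ t ∈ S' ∩ U, ν t) + (∑ t ∈ S', ν t) * (∑ t ∈ S ∩ U, ν t))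
            - (∑ r ∈ U, ν r) * (∑ t ∈ S, ν t) * (∑ t ∈ S', ν t)
          ≤ ∑ t ∈ (S ∩ S') ∩ U, R' t
            + ∑ s ∈ (S ∩ S') ∩ Uᶜ, (∑ t ∈ U, F t s - (∑ r, ν r) * (∑ r ∈ U, ν r) * ν s)) := by
  -- nonnegativity of the scalars and of `ν`, `R`
  have hvb0 : 0 ≤ vb := by rw [← hvb]; exact Finset.sum_nonneg fun b _ => hw b
  have hgb0 : 0 ≤ gb := by rw [← hgb]; exact Finset.sum_nonneg fun t _ => hν' t
  have hν0 : ∀ x, 0 ≤ ν x := fun x => by rw [hν]; exact mul_nonneg (hw _) (hν' _)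
  have hR0 : ∀ x, 0 ≤ R x := by
    rintro ⟨b, t⟩
    rw [hR]; dsimp only
    split_ifs with hb ht ht'
    · have := hw b; have := hν' t; positivity
    · exact mul_nonneg (hφ0 b hb) (hν' t)
    · exact mul_nonneg (hw b) (hψ0 t ht')
    · exact le_rfl
  -- masses: `ν(univ) = 1`, `ν(Uᶜ) = v̄ḡ`, `ν(U) = v + v̄g`
  have hZ : ∑ x, ν x = 1 := by
    rw [Fintype.sum_prod_type]
    have e : ∑ b, ∑ t, ν (b, t) = ∑ b, ∑ t, w b * ν' t :=
      Finset.sum_congr rfl fun b _ => Finset.sum_congr rfl fun t _ => hν (b, t)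
    rw [e, ← Finset.sum_mul_sum, hwZ, hν'Z, one_mul]
  have hDm : ∑ x ∈ Uᶜ, ν x = vb * gb := by
    rw [SahiE3IndepOrReduction.mass_compl_slot w ν' ν (fun b s => hν (b, s)) V G U hU, hvb, hgb]
  have hv1 : v + vb = 1 := by rw [← hv, ← hvb, Finset.sum_add_sum_compl, hwZ]
  have hg1 : g + gb = 1 := by rw [← hg, ← hgb, Finset.sum_add_sum_compl, hν'Z]
  have hUm : ∑ x ∈ U, ν x = v + vb * g := by
    have h := Finset.sum_add_sum_compl U ν
    rw [hZ, hDm] at h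
    have : v + vb * g = 1 - vb * gb := by
      have hv' : v = 1 - vb := by linarith
      have hg' : g = 1 - gb := by linarith
      rw [hv', hg']; ring
    linarith
  -- the two sandwich conditions
  have hC := fun W hW => cap_flatTheta hw hν' V G RV RG hRV0 hRG0 hCV hCG hc₁ hc₂ hk₁ hk₂ hdel φ hφ ψ hψ ν hν R hR U hU W hW
  refine exists_certificate_of_sandwich U ν R hν0 hR0 ?_ ?_
  · intro S S' hS hS'
    rw [hZ, hUm, one_mul]
    exact hpair S S' hS hS'
  · intro W hW
    rw [hZ, hUm, hDm, one_mul, one_mul]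
    exact hC W hW

end Summit.CriticalPhenomena.PercolationContinuityZ3.Theorems.SahiE3IndepOrFlatCert
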